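import Literature.NumberTheory.EllipticCurves.ReductionHomomorphism
import Literature.NumberTheory.EllipticCurves.SingularCubic
import Literature.NumberTheory.EllipticCurves.VariableChangePointsMap
import HarnessLib

/-!
# The reduction map onto the torus at a node, explicitly: `E₀(K) → Ẽ_ns(k) ≅ kˣ` through
# Silverman's node map (AEC VII.2.1 with III.2.5(a))

Sibling proof file (theorems only) of `ReductionHomomorphism` (`reducePoint`, `reductionHom`,
`E₀ = nonsingularReductionSubgroup`, `E₁ = ReducesToZero`; Silverman *AEC* VII.2.1) and
`SingularCubic` (`singularModel`, `nodeHom`; *AEC* III.2.5(a)), one step below the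
torsion-point forms of Serre–Tate's Lemma 2 at the multiplicative places
(`HasseWeilAbelianEulerFactorTorsionProofs`: an equivariant reduction datum `r : A' → k'ˣ` with
kernel `E₁`).  `ReductionHomomorphismCuspNodeProofs.exists_addMonoidHom_units_of_node` produces
such an `r` abstractly (through a *chosen* isomorphism `Ẽ_ns(k̄) ≅ k̄ˣ`), which does not allow one
to compute how `r` transforms under automorphisms of `K`.  Here the node is *presented*,
`W̃ = singularModel x₀ y₀ α₁ α₂` (`α₁ ≠ α₂`) over the residue field itself, and

* `WeierstrassCurve.exists_addMonoidHom_units_of_map_eq_singularModel`: **`r = ψ ∘ (reduction)`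
  is a homomorphism `E₀(K) → kˣ` with kernel `E₁(K)`, given on integral points with non-singular
  reduction by `r(a, b) = ψ(ā, b̄)`**, `ψ = (y - α₁x - β₁)/(y - α₂x - β₂)` Silverman's node map
  (`singularModel.nodeFun`).

With `SingularCubicMapProofs` (`ψ` commutes with ring homomorphisms; swapping the slopes inverts
`ψ`; an endomorphism of `k` fixing `W̃` fixes the singular point and fixes-or-swaps the slopes)
this gives the Galois behaviour of `r` at a split, resp. non-split, node (Silverman, *AEC*,
Exercise 3.5(a)).

## References

* J. H. Silverman, *The Arithmetic of Elliptic Curves*, 2nd ed. (2009), VII.2 Prop. 2.1 (PDF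
  p. 167), Prop. III.2.5(a) (PDF p. 59), Exercise 3.5(a). [SilvermanAEC2009]

## Design

Theorems only (the map is produced existentially with its kernel and its formula, as in
`ReductionHomomorphismCuspNodeProofs`); `open scoped Classical` (the group law on
`Affine.Point` and `Affine.Point.congrEquiv` want `DecidableEq`); the general setting of
`ReductionHomomorphism` (`K` a field with a valuation `v`, `R` a local subring with
`hv : v.Integers R`).
-/

noncomputable section

open scoped Classical

namespace WeierstrassCurve

variable {K : Type*} [Field K] {Γ₀ : Type*} [LinearOrderedCommGroupWithZero Γ₀]
  {v : Valuation K Γ₀} {R : Type*} [CommRing R] [IsLocalRing R] [Algebra R K]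
  (W : WeierstrassCurve R)

/-- **Multiplicative reduction, explicitly: `E₀(K) → kˣ` through the node map.**  Let `W` be a
Weierstrass equation over a valuation ring `R` of `K` (`hv : v.Integers R`) whose reduction is a
node presented as a singular model, `W̃ = singularModel x₀ y₀ α₁ α₂` with `α₁ ≠ α₂` over the
residue field `k` (e.g. `k` algebraically closed: `SingularCubic.exists_singularPoint`,
`exists_tangentSlopes`, `eq_singularModel`).  Then the composite of the reduction homomorphism
`E₀(K) → Ẽ_ns(k)` (Silverman, *AEC* VII.2.1; `reductionHom`) with Silverman's node map
`ψ = (y - α₁x - β₁)/(y - α₂x - β₂) : Ẽ_ns(k) ≅ kˣ` (*AEC* III.2.5(a); `singularModel.nodeHom`) is a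
homomorphism `r : E₀(K) → kˣ` with kernel exactly `E₁(K)` **and given on the points with
integral coordinates and non-singular reduction by the formula `r(a, b) = ψ(ā, b̄)`** (on `E₁(K)`
it is `1`).  The formula is what makes the Galois behaviour of `r` computable
(`SingularCubicMapProofs`: `ψ` commutes with ring homomorphisms fixing the slopes and is inverted
by swapping them).  Compare `exists_addMonoidHom_units_of_node` (`ReductionHomomorphismCuspNodeProofs`),
which gives such an `r` into `k̄ˣ` abstractly (kernel only).
[cite: SilvermanAEC2009, VII.2 Prop. 2.1 and Prop. III.2.5(a) (PDF pp. 167, 59)] -/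
theorem exists_addMonoidHom_units_of_map_eq_singularModel (hv : v.Integers R)
    {x₀ y₀ α₁ α₂ : IsLocalRing.ResidueField R}
    (hW : W.map (IsLocalRing.residue R) = singularModel x₀ y₀ α₁ α₂) (hα : α₁ ≠ α₂) :
    ∃ r : W.nonsingularReductionSubgroup hv →+ Additive (IsLocalRing.ResidueField R)ˣ,
      (∀ P : W.nonsingularReductionSubgroup hv,
          r P = 0 ↔ W.ReducesToZero (P : (W.baseChange K).toAffine.Point)) ∧
      ∀ (a b : R) (h : (W.baseChange K).toAffine.Nonsingular (algebraMap R K a) (algebraMap R K b))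
        (hns : (singularModel x₀ y₀ α₁ α₂).toAffine.Nonsingular (IsLocalRing.residue R a)
          (IsLocalRing.residue R b))
        (hP : W.HasNonsingularReduction (.some _ _ h)),
        ((r ⟨.some _ _ h, hP⟩).toMul : IsLocalRing.ResidueField R) =
          singularModel.nodeFun x₀ y₀ α₁ α₂ (.some _ _ hns) := by
  let e := Affine.Point.congrEquiv hW
  let r : W.nonsingularReductionSubgroup hv →+ Additive (IsLocalRing.ResidueField R)ˣ :=
    (singularModel.nodeHom x₀ y₀ α₁ α₂).comp (e.toAddMonoidHom.comp (W.reductionHom hv))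
  have hr : ∀ P : W.nonsingularReductionSubgroup hv,
      r P = singularModel.nodeHom x₀ y₀ α₁ α₂
        (e (W.reducePoint (P : (W.baseChange K).toAffine.Point))) := fun _ ↦ rfl
  refine ⟨r, fun P ↦ ?_, fun a b h hns hP ↦ ?_⟩
  · rw [hr, ← reducePoint_eq_zero_iff hv P.2, ← (singularModel.nodeHom x₀ y₀ α₁ α₂).map_zero,
      (singularModel.nodeHom_injective hα).eq_iff, e.map_eq_zero_iff]
  · have hns' : (W.map (IsLocalRing.residue R)).toAffine.Nonsingular (IsLocalRing.residue R a)
        (IsLocalRing.residue R b) := by rw [hW]; exact hns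
    rw [hr]
    change ((Additive.toMul (singularModel.nodeHom x₀ y₀ α₁ α₂
      (e (W.reducePoint (.some _ _ h)))) : (IsLocalRing.ResidueField R)ˣ) :
        IsLocalRing.ResidueField R) = _
    rw [reducePoint_some_algebraMap hv.hom_inj h hns', singularModel.coe_toMul_nodeHom]
    change singularModel.nodeFun x₀ y₀ α₁ α₂ (Affine.Point.congrEquiv hW (.some _ _ hns')) = _
    rw [Affine.Point.congrEquiv_some]

end WeierstrassCurve

end
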